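import Mathlib
import Summits.Ventures.PercRepro2.CoinChainAWorldLemmas

/-!
# The pure AND-switch chain when the gate density is decreasing — FKG twice
(blind cell PercRepro2, night-2 g19; proofs/NIGHT2-DARC.md §59.7)

Pure chain (§58.1): κ-integrated `R`-law `ν · chainMix ∅ ent' ρ c d`, gate
`ν · chainMix ∅ ent' ρ c d'`.  Both are log-supermodular (`mixture_lsm`).  If the gate density
`h = chainMix ρ c d' / chainMix ρ c d` is DECREASING along inclusion (hypothesis `hdec`, in
cleared form `chainMix ρ c d' t · chainMix ρ c d s ≤ chainMix ρ c d' s · chainMix ρ c d t` for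
`s ⊆ t`), then the gate is Holley-BELOW the `R`-law, both marker means move DOWN, the shift
product is nonnegative, and FKG for the gate gives the functional (`aw_fkg_sums`,
`aw_holley_sums`): `pureChain_functional_nonneg_of_decreasing`.  On `𝒟` the density is
`1 − (1 − v)·ρu/(1 − ρ + ρu)` (`u = d/c`, `v = d'/d`), so `hdec` holds e.g. whenever `v` is
constant on `𝒟` (the vertex `w` reaches the target independently of the core; the «coverage»
and «direct w → t» heads): `pureChain_functional_nonneg_of_constV`.  A third sufficient
condition of the row, independent of the same-sign one (§58.4) and of the `A`-law one (§59);
on the exact census of enumerated heads the three together cover 434 / 450 checks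
(mining/night-2/g19/cover.py).
-/

namespace Summit.Ventures.PercRepro2.Coin

section ChainDecreasing

variable {V : Type*} [DecidableEq V] {R : Type*} [Field R] [LinearOrder R] [IsStrictOrderedRing R]

/-- A weight `G` below a log-supermodular weight `F` with a decreasing density (`hdec`, in
cleared form) is Holley-below it: `G s · F t ≤ G (s ∩ t) · F (s ∪ t)`. -/
lemma holley_of_density_dec (F G : Finset V → R) (hF0 : ∀ W, 0 ≤ F W) (hG0 : ∀ W, 0 ≤ G W)
    (hFlsm : ∀ s t, F s * F t ≤ F (s ∩ t) * F (s ∪ t)) (hGF : ∀ W, G W ≤ F W)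
    (hdec : ∀ s t, s ⊆ t → G t * F s ≤ G s * F t) (s t : Finset V) :
    G s * F t ≤ G (s ∩ t) * F (s ∪ t) := by
  have h1 := hdec (s ∩ t) s Finset.inter_subset_left
  have h2 := hFlsm s t
  have hY : 0 ≤ G (s ∩ t) * F (s ∪ t) := mul_nonneg (hG0 _) (hF0 _)
  by_cases hz : F (s ∩ t) = 0
  · have h0 : F s * F t = 0 := by
      apply le_antisymm _ (mul_nonneg (hF0 s) (hF0 t))
      calc F s * F t ≤ F (s ∩ t) * F (s ∪ t) := h2
        _ = 0 := by rw [hz, zero_mul]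
    rcases mul_eq_zero.mp h0 with h | h
    · have hg : G s = 0 := le_antisymm (by rw [← h]; exact hGF s) (hG0 s)
      rw [hg, zero_mul]; exact hY
    · rw [h, mul_zero]; exact hY
  · have hpos : 0 < F (s ∩ t) := lt_of_le_of_ne (hF0 _) (Ne.symm hz)
    have key : G s * F t * F (s ∩ t) ≤ G (s ∩ t) * F (s ∪ t) * F (s ∩ t) := by
      calc G s * F t * F (s ∩ t) = (G s * F (s ∩ t)) * F t := by ring
        _ ≤ (G (s ∩ t) * F s) * F t := mul_le_mul_of_nonneg_right h1 (hF0 t)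
        _ = G (s ∩ t) * (F s * F t) := by ring
        _ ≤ G (s ∩ t) * (F (s ∩ t) * F (s ∪ t)) := mul_le_mul_of_nonneg_left h2 (hG0 _)
        _ = G (s ∩ t) * F (s ∪ t) * F (s ∩ t) := by ring
    exact le_of_mul_le_mul_right key hpos

/-- The cleared functional from FKG for the gate and the Holley comparison gate `≼` `R`-law
(both gate means BELOW the `R`-means), in the moments. -/
lemma dec_T_nonneg (a0 a1 a2 g0 g1 g2 g12 : R) (hg0 : 0 ≤ g0) (hg1 : 0 ≤ g1) (hg2 : 0 ≤ g2)
    (hg12 : 0 ≤ g12) (hg1le : g1 ≤ g0) (hg2le : g2 ≤ g0) (hg12le : g12 ≤ g0)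
    (hFG : g1 * g2 ≤ g0 * g12) (hH1 : g1 * a0 ≤ g0 * a1) (hH2 : g2 * a0 ≤ g0 * a2) :
    0 ≤ a0 ^ 2 * g12 - a0 * a1 * g2 - a0 * a2 * g1 + a1 * a2 * g0 := by
  rcases eq_or_lt_of_le hg0 with h | h
  · have hg1z : g1 = 0 := le_antisymm (by rw [h]; exact hg1le) hg1
    have hg2z : g2 = 0 := le_antisymm (by rw [h]; exact hg2le) hg2
    have hg12z : g12 = 0 := le_antisymm (by rw [h]; exact hg12le) hg12
    rw [← h, hg1z, hg2z, hg12z]; ring_nf; exact le_refl _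
  · have key : g0 * (a0 ^ 2 * g12 - a0 * a1 * g2 - a0 * a2 * g1 + a1 * a2 * g0) =
        a0 ^ 2 * (g0 * g12 - g1 * g2) + (a0 * g1 - a1 * g0) * (a0 * g2 - a2 * g0) := by ring
    have hpos : 0 ≤ g0 * (a0 ^ 2 * g12 - a0 * a1 * g2 - a0 * a2 * g1 + a1 * a2 * g0) := by
      rw [key]
      exact add_nonneg (mul_nonneg (sq_nonneg _) (by linarith))
        (mul_nonneg_of_nonpos_of_nonpos (by linarith) (by linarith))
    exact (mul_nonneg_iff_of_pos_left h).mp hpos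

/-- **THE PURE CHAIN WITH A DECREASING GATE DENSITY.**  `ν` log-supermodular on `U.powerset`,
the head values with the hypotheses of `mixture_lsm` for `(c, d)` and `(c, d')`, `d' ≤ d`, and
the gate density decreasing (`hdec`): the cleared functional is `≥ 0`.  Proof: FKG for the
gate and the Holley comparison gate `≼` `R`-law (both marker means of the gate lie below the
`R`-means), so the shift product is nonnegative. -/
theorem pureChain_functional_nonneg_of_decreasing (U ent' : Finset V) (ν c d d' : Finset V → R)
    (ρ : R) (hρ0 : 0 ≤ ρ) (hρ1 : ρ ≤ 1) (hν0 : ∀ W, 0 ≤ ν W)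
    (hν : ∀ s ⊆ U, ∀ t ⊆ U, ν s * ν t ≤ ν (s ∩ t) * ν (s ∪ t))
    (hc0 : ∀ W, 0 ≤ c W) (hd0 : ∀ W, 0 ≤ d W) (hd'0 : ∀ W, 0 ≤ d' W)
    (hdc : ∀ W, d W ≤ c W) (hd'c : ∀ W, d' W ≤ c W) (hd'd : ∀ W, d' W ≤ d W)
    (hcc : ∀ s t, c s * c t ≤ c (s ∩ t) * c (s ∪ t))
    (hdd : ∀ s t, d s * d t ≤ d (s ∩ t) * d (s ∪ t))
    (hd'd' : ∀ s t, d' s * d' t ≤ d' (s ∩ t) * d' (s ∪ t))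
    (hcd : ∀ s t, c s * d t ≤ c (s ∩ t) * d (s ∪ t))
    (hcd' : ∀ s t, c s * d' t ≤ c (s ∩ t) * d' (s ∪ t))
    (hratio : ∀ s t, s ⊆ t → d s * c t ≤ c s * d t)
    (hratio' : ∀ s t, s ⊆ t → d' s * c t ≤ c s * d' t)
    (hdec : ∀ s t, s ⊆ t → chainMix ∅ ent' ρ c d' t * chainMix ∅ ent' ρ c d s ≤
      chainMix ∅ ent' ρ c d' s * chainMix ∅ ent' ρ c d t) (m₁ m₂ : V) :
    0 ≤ (∑ W ∈ U.powerset, ν W * chainMix ∅ ent' ρ c d W) ^ 2 *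
          (∑ W ∈ U.powerset, ν W * chainMix ∅ ent' ρ c d' W *
            ((if m₁ ∈ W then (1 : R) else 0) * (if m₂ ∈ W then (1 : R) else 0)))
        - (∑ W ∈ U.powerset, ν W * chainMix ∅ ent' ρ c d W) *
          (∑ W ∈ U.powerset, ν W * chainMix ∅ ent' ρ c d W * (if m₁ ∈ W then (1 : R) else 0)) *
          (∑ W ∈ U.powerset, ν W * chainMix ∅ ent' ρ c d' W * (if m₂ ∈ W then (1 : R) else 0))
        - (∑ W ∈ U.powerset, ν W * chainMix ∅ ent' ρ c d W) *
          (∑ W ∈ U.powerset, ν W * chainMix ∅ ent' ρ c d W * (if m₂ ∈ W then (1 : R) else 0)) *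
          (∑ W ∈ U.powerset, ν W * chainMix ∅ ent' ρ c d' W * (if m₁ ∈ W then (1 : R) else 0))
        + (∑ W ∈ U.powerset, ν W * chainMix ∅ ent' ρ c d W * (if m₁ ∈ W then (1 : R) else 0)) *
          (∑ W ∈ U.powerset, ν W * chainMix ∅ ent' ρ c d W * (if m₂ ∈ W then (1 : R) else 0)) *
          (∑ W ∈ U.powerset, ν W * chainMix ∅ ent' ρ c d' W) := by
  have hx0 : ∀ W : Finset V, (0 : R) ≤ (if m₁ ∈ W then (1 : R) else 0) := by
    intro W; split_ifs <;> norm_num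
  have hy0 : ∀ W : Finset V, (0 : R) ≤ (if m₂ ∈ W then (1 : R) else 0) := by
    intro W; split_ifs <;> norm_num
  have hxm : ∀ s t : Finset V,
      (if m₁ ∈ s then (1 : R) else 0) ≤ (if m₁ ∈ s ∪ t then (1 : R) else 0) := by
    intro s t
    by_cases h : m₁ ∈ s
    · rw [if_pos h, if_pos (Finset.mem_union_left t h)]
    · rw [if_neg h]; split_ifs <;> norm_num
  have hym : ∀ s t : Finset V,
      (if m₂ ∈ s then (1 : R) else 0) ≤ (if m₂ ∈ s ∪ t then (1 : R) else 0) := by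
    intro s t
    by_cases h : m₂ ∈ s
    · rw [if_pos h, if_pos (Finset.mem_union_left t h)]
    · rw [if_neg h]; split_ifs <;> norm_num
  obtain ⟨Rl, hRl⟩ : ∃ Rl : Finset V → R, ∀ W, Rl W = ν W * chainMix ∅ ent' ρ c d W :=
    ⟨_, fun _ => rfl⟩
  obtain ⟨Gl, hGl⟩ : ∃ Gl : Finset V → R, ∀ W, Gl W = ν W * chainMix ∅ ent' ρ c d' W :=
    ⟨_, fun _ => rfl⟩
  have hm0 : ∀ W, 0 ≤ chainMix ∅ ent' ρ c d W := chainMix_nonneg ∅ ent' hρ0 hρ1 hc0 hd0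
  have hm'0 : ∀ W, 0 ≤ chainMix ∅ ent' ρ c d' W := chainMix_nonneg ∅ ent' hρ0 hρ1 hc0 hd'0
  have hmle : ∀ W, chainMix ∅ ent' ρ c d' W ≤ chainMix ∅ ent' ρ c d W := by
    intro W
    unfold chainMix
    have := chainTheta_nonneg ∅ ent' hρ0 W
    nlinarith [hd'd W]
  have hR0 : ∀ W, 0 ≤ Rl W := fun W => by rw [hRl]; exact mul_nonneg (hν0 W) (hm0 W)
  have hG0 : ∀ W, 0 ≤ Gl W := fun W => by rw [hGl]; exact mul_nonneg (hν0 W) (hm'0 W)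
  have hmix := mixture_lsm ∅ ent' ρ hρ0 hρ1 c d hc0 hd0 hdc hcc hdd hcd hratio
  have hmix' := mixture_lsm ∅ ent' ρ hρ0 hρ1 c d' hc0 hd'0 hd'c hcc hd'd' hcd' hratio'
  have hGlsm : ∀ s ⊆ U, ∀ t ⊆ U, Gl s * Gl t ≤ Gl (s ∩ t) * Gl (s ∪ t) := by
    intro s hs t ht
    rw [hGl, hGl, hGl, hGl]
    calc ν s * chainMix ∅ ent' ρ c d' s * (ν t * chainMix ∅ ent' ρ c d' t)
        = (ν s * ν t) * (chainMix ∅ ent' ρ c d' s * chainMix ∅ ent' ρ c d' t) := by ring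
      _ ≤ (ν (s ∩ t) * ν (s ∪ t)) *
            (chainMix ∅ ent' ρ c d' (s ∩ t) * chainMix ∅ ent' ρ c d' (s ∪ t)) :=
          mul_le_mul (hν s hs t ht) (hmix' s t) (mul_nonneg (hm'0 _) (hm'0 _))
            (mul_nonneg (hν0 _) (hν0 _))
      _ = _ := by ring
  have hdom : ∀ s ⊆ U, ∀ t ⊆ U, Gl s * Rl t ≤ Gl (s ∩ t) * Rl (s ∪ t) := by
    intro s hs t ht
    rw [hGl, hGl, hRl, hRl]
    have key := holley_of_density_dec (chainMix ∅ ent' ρ c d) (chainMix ∅ ent' ρ c d') hm0 hm'0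
      hmix hmle hdec s t
    calc ν s * chainMix ∅ ent' ρ c d' s * (ν t * chainMix ∅ ent' ρ c d t)
        = (ν s * ν t) * (chainMix ∅ ent' ρ c d' s * chainMix ∅ ent' ρ c d t) := by ring
      _ ≤ (ν (s ∩ t) * ν (s ∪ t)) *
            (chainMix ∅ ent' ρ c d' (s ∩ t) * chainMix ∅ ent' ρ c d (s ∪ t)) :=
          mul_le_mul (hν s hs t ht) key (mul_nonneg (hm'0 _) (hm0 _))
            (mul_nonneg (hν0 _) (hν0 _))
      _ = _ := by ring
  have hFG := aw_fkg_sums U Gl (fun W => if m₁ ∈ W then (1 : R) else 0)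
    (fun W => if m₂ ∈ W then (1 : R) else 0) hG0 hx0 hy0 hxm hym hGlsm
  have hH1 := aw_holley_sums U Gl Rl (fun W => if m₁ ∈ W then (1 : R) else 0) hG0 hR0 hx0 hxm
    hdom
  have hH2 := aw_holley_sums U Gl Rl (fun W => if m₂ ∈ W then (1 : R) else 0) hG0 hR0 hy0 hym
    hdom
  have hx1 : ∀ W : Finset V, (if m₁ ∈ W then (1 : R) else 0) ≤ 1 := by
    intro W; split_ifs <;> norm_num
  have hy1 : ∀ W : Finset V, (if m₂ ∈ W then (1 : R) else 0) ≤ 1 := by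
    intro W; split_ifs <;> norm_num
  have hg0 : 0 ≤ ∑ W ∈ U.powerset, Gl W := Finset.sum_nonneg fun W _ => hG0 W
  have hg1 : 0 ≤ ∑ W ∈ U.powerset, Gl W * (if m₁ ∈ W then (1 : R) else 0) :=
    Finset.sum_nonneg fun W _ => mul_nonneg (hG0 W) (hx0 W)
  have hg2 : 0 ≤ ∑ W ∈ U.powerset, Gl W * (if m₂ ∈ W then (1 : R) else 0) :=
    Finset.sum_nonneg fun W _ => mul_nonneg (hG0 W) (hy0 W)
  have hg12 : 0 ≤ ∑ W ∈ U.powerset, Gl W *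
      ((if m₁ ∈ W then (1 : R) else 0) * (if m₂ ∈ W then (1 : R) else 0)) :=
    Finset.sum_nonneg fun W _ => mul_nonneg (hG0 W) (mul_nonneg (hx0 W) (hy0 W))
  have hg1le : ∑ W ∈ U.powerset, Gl W * (if m₁ ∈ W then (1 : R) else 0) ≤
      ∑ W ∈ U.powerset, Gl W :=
    Finset.sum_le_sum fun W _ => mul_le_of_le_one_right (hG0 W) (hx1 W)
  have hg2le : ∑ W ∈ U.powerset, Gl W * (if m₂ ∈ W then (1 : R) else 0) ≤
      ∑ W ∈ U.powerset, Gl W :=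
    Finset.sum_le_sum fun W _ => mul_le_of_le_one_right (hG0 W) (hy1 W)
  have hg12le : ∑ W ∈ U.powerset, Gl W *
      ((if m₁ ∈ W then (1 : R) else 0) * (if m₂ ∈ W then (1 : R) else 0)) ≤
      ∑ W ∈ U.powerset, Gl W :=
    Finset.sum_le_sum fun W _ =>
      mul_le_of_le_one_right (hG0 W) (mul_le_one₀ (hx1 W) (hy0 W) (hy1 W))
  have eR : ∀ f : Finset V → R, ∑ W ∈ U.powerset, ν W * chainMix ∅ ent' ρ c d W * f W =
      ∑ W ∈ U.powerset, Rl W * f W := fun f => Finset.sum_congr rfl fun W _ => by rw [hRl]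
  have eG : ∀ f : Finset V → R, ∑ W ∈ U.powerset, ν W * chainMix ∅ ent' ρ c d' W * f W =
      ∑ W ∈ U.powerset, Gl W * f W := fun f => Finset.sum_congr rfl fun W _ => by rw [hGl]
  have eR0 : ∑ W ∈ U.powerset, ν W * chainMix ∅ ent' ρ c d W = ∑ W ∈ U.powerset, Rl W :=
    Finset.sum_congr rfl fun W _ => by rw [hRl]
  have eG0 : ∑ W ∈ U.powerset, ν W * chainMix ∅ ent' ρ c d' W = ∑ W ∈ U.powerset, Gl W :=
    Finset.sum_congr rfl fun W _ => by rw [hGl]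
  rw [eR0, eG0, eR (fun W => if m₁ ∈ W then (1 : R) else 0), eR (fun W => if m₂ ∈ W then (1 : R) else 0),
    eG (fun W => if m₁ ∈ W then (1 : R) else 0), eG (fun W => if m₂ ∈ W then (1 : R) else 0),
    eG (fun W => (if m₁ ∈ W then (1 : R) else 0) * (if m₂ ∈ W then (1 : R) else 0))]
  exact dec_T_nonneg _ _ _ _ _ _ _ hg0 hg1 hg2 hg12 hg1le hg2le hg12le hFG hH1 hH2

/-- The gate density is decreasing when `v = d'/d` is CONSTANT on the entered clusters
(`d' W = κ · d W` for `W` meeting `ent'`, `0 ≤ κ ≤ 1`): in cleared form,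
`chainMix ρ c d' t · chainMix ρ c d s ≤ chainMix ρ c d' s · chainMix ρ c d t` for `s ⊆ t`. -/
lemma chainMix_dec_of_constV (ent' : Finset V) (ρ : R) (hρ0 : 0 ≤ ρ) (hρ1 : ρ ≤ 1)
    (c d d' : Finset V → R) (hc0 : ∀ W, 0 ≤ c W) (hd0 : ∀ W, 0 ≤ d W)
    (hratio : ∀ s t, s ⊆ t → d s * c t ≤ c s * d t) (κ : R) (hκ1 : κ ≤ 1)
    (hconst : ∀ W, (∃ r ∈ ent', r ∈ W) → d' W = κ * d W) (s t : Finset V) (hst : s ⊆ t) :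
    chainMix ∅ ent' ρ c d' t * chainMix ∅ ent' ρ c d s ≤
      chainMix ∅ ent' ρ c d' s * chainMix ∅ ent' ρ c d t := by
  have hR := hratio s t hst
  have hρ' : (0 : R) ≤ 1 - ρ := by linarith
  unfold chainMix
  rw [chainTheta_empty, chainTheta_empty]
  by_cases hs : ∃ r ∈ ent', r ∈ s <;> by_cases ht : ∃ r ∈ ent', r ∈ t
  · rw [hconst s hs, hconst t ht]
    simp only [hs, ht, if_true]
    have hc0s := hc0 s; have hc0t := hc0 t; have hd0s := hd0 s; have hd0t := hd0 t
    nlinarith [mul_le_mul_of_nonneg_left hR (mul_nonneg (mul_nonneg hρ' hρ0) (by linarith : (0 : R) ≤ 1 - κ))]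
  · exact absurd (by obtain ⟨r, hr, hrs⟩ := hs; exact ⟨r, hr, hst hrs⟩) ht
  · rw [hconst t ht]
    simp only [hs, ht, if_true, if_false, sub_zero, one_mul, zero_mul, add_zero]
    have hc0s := hc0 s; have hc0t := hc0 t; have hd0t := hd0 t
    nlinarith [mul_nonneg (mul_nonneg hρ0 hd0t) (mul_nonneg hc0s (by linarith : (0 : R) ≤ 1 - κ))]
  · simp only [hs, ht, if_false, sub_zero, one_mul, zero_mul, add_zero]
    exact le_of_eq (mul_comm _ _)

/-- **COROLLARY.**  The pure chain is nonnegative at every coin probability whenever `w`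
reaches the target independently of the core: `d' = κ · d` on the entered clusters (`κ ≤ 1`;
`κ ≥ 0` is implied by `d' ≥ 0` wherever `d > 0`). -/
theorem pureChain_functional_nonneg_of_constV (U ent' : Finset V) (ν c d d' : Finset V → R)
    (ρ : R) (hρ0 : 0 ≤ ρ) (hρ1 : ρ ≤ 1) (hν0 : ∀ W, 0 ≤ ν W)
    (hν : ∀ s ⊆ U, ∀ t ⊆ U, ν s * ν t ≤ ν (s ∩ t) * ν (s ∪ t))
    (hc0 : ∀ W, 0 ≤ c W) (hd0 : ∀ W, 0 ≤ d W) (hd'0 : ∀ W, 0 ≤ d' W)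
    (hdc : ∀ W, d W ≤ c W) (hd'c : ∀ W, d' W ≤ c W) (hd'd : ∀ W, d' W ≤ d W)
    (hcc : ∀ s t, c s * c t ≤ c (s ∩ t) * c (s ∪ t))
    (hdd : ∀ s t, d s * d t ≤ d (s ∩ t) * d (s ∪ t))
    (hd'd' : ∀ s t, d' s * d' t ≤ d' (s ∩ t) * d' (s ∪ t))
    (hcd : ∀ s t, c s * d t ≤ c (s ∩ t) * d (s ∪ t))
    (hcd' : ∀ s t, c s * d' t ≤ c (s ∩ t) * d' (s ∪ t))
    (hratio : ∀ s t, s ⊆ t → d s * c t ≤ c s * d t)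
    (hratio' : ∀ s t, s ⊆ t → d' s * c t ≤ c s * d' t)
    (κ : R) (hκ1 : κ ≤ 1)
    (hconst : ∀ W, (∃ r ∈ ent', r ∈ W) → d' W = κ * d W) (m₁ m₂ : V) :
    0 ≤ (∑ W ∈ U.powerset, ν W * chainMix ∅ ent' ρ c d W) ^ 2 *
          (∑ W ∈ U.powerset, ν W * chainMix ∅ ent' ρ c d' W *
            ((if m₁ ∈ W then (1 : R) else 0) * (if m₂ ∈ W then (1 : R) else 0)))
        - (∑ W ∈ U.powerset, ν W * chainMix ∅ ent' ρ c d W) *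
          (∑ W ∈ U.powerset, ν W * chainMix ∅ ent' ρ c d W * (if m₁ ∈ W then (1 : R) else 0)) *
          (∑ W ∈ U.powerset, ν W * chainMix ∅ ent' ρ c d' W * (if m₂ ∈ W then (1 : R) else 0))
        - (∑ W ∈ U.powerset, ν W * chainMix ∅ ent' ρ c d W) *
          (∑ W ∈ U.powerset, ν W * chainMix ∅ ent' ρ c d W * (if m₂ ∈ W then (1 : R) else 0)) *
          (∑ W ∈ U.powerset, ν W * chainMix ∅ ent' ρ c d' W * (if m₁ ∈ W then (1 : R) else 0))
        + (∑ W ∈ U.powerset, ν W * chainMix ∅ ent' ρ c d W * (if m₁ ∈ W then (1 : R) else 0)) *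
          (∑ W ∈ U.powerset, ν W * chainMix ∅ ent' ρ c d W * (if m₂ ∈ W then (1 : R) else 0)) *
          (∑ W ∈ U.powerset, ν W * chainMix ∅ ent' ρ c d' W) :=
  pureChain_functional_nonneg_of_decreasing U ent' ν c d d' ρ hρ0 hρ1 hν0 hν hc0 hd0 hd'0 hdc
    hd'c hd'd hcc hdd hd'd' hcd hcd' hratio hratio'
    (fun s t hst => chainMix_dec_of_constV ent' ρ hρ0 hρ1 c d d' hc0 hd0 hratio κ hκ1 hconst
      s t hst) m₁ m₂

end ChainDecreasing

end Summit.Ventures.PercRepro2.Coin
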